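import Literature.Geometry.Symplectic.OrigamiModelForm
import Mathlib.Analysis.InnerProductSpace.Calculus
import HarnessLib

/-!
# The form `p^*ω_Z + d(|w|² p^*α) - 2 dx∧dy` on `N × ℂ` (the reduced form of the symplectic cut,
# before reduction)

Proofs companion of `OrigamiUnfolding.lean` (the named fact
`Literature.Geometry.Symplectic.exists_symplecticCutPieces_of_isOrigamiForm`, Cannas da
Silva–Guillemin–Pires, *Symplectic Origami*, IMRN 2011 = arXiv:0909.4065, Prop. 2.8; architecture
in `OrigamiUnfoldingProofs.lean`), step (S2): the cut piece near the centre is the associated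
disc bundle `Z ×_{S¹} D²` with its reduced symplectic form (§2.3 and proof of Prop. 2.8: the
reduced space `μ⁻¹(0)/S¹` of `Z × (-ε, ε) × ℂ`).  Instead of performing the reduction we write
the pull-back of the reduced form to `Z × ℂ` down directly: for a `2`-form `ωZ` and a `1`-form
`α` on a manifold `N` modelled on `ℝᵐ` the form

  `prodCutForm ωZ α = ωZ.pullback _ Prod.fst + d (|w|² • α.pullback _ Prod.fst) + (-2) • dx∧dy`

on `N × ℂ` (model `(𝓡 m).prod 𝓘(ℝ, ℂ)`), which along the real slice `w = t ∈ ℝ` is EXACTLY the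
model form `p^*ωZ + d(t² p^*α)` of `OrigamiModelForm.lean` (`prodCutForm_apply_ofReal`), and
which is basic for the diagonal circle action when `α` is a connection form (sequel), hence
descends to `N ×_{S¹} ℂ`.  This file proves the pointwise formula

* `prodCutForm_apply` — `Ω_{(n,w)}((a,σ),(b,τ)) = ωZ_n(a,b) + |w|² dα_n(a,b)`
  `+ 2⟪w,σ⟫ α_n(b) - 2⟪w,τ⟫ α_n(a) - 2 (σ₁τ₂ - σ₂τ₁)` (Leibniz rule, naturality of `d`,
  `d|w|² = 2⟪w, ·⟫` read in the product chart, whose `ℂ`-factor is the identity);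
* `isSmoothForm_prodCutForm`, `isClosedForm_prodCutForm` (for smooth `ωZ`, `α`, closed `ωZ`);
* `areaFormC` — the constant area form `dx ∧ dy` of `ℂ` as an `MForm`, `areaFormC_apply`;
* `prodCutForm_apply_ofReal` — the restriction to the real slice is the model form.

Everything here is proved; the definitions (`areaAltC`, `areaFormC`, `prodCutForm`) are explicit
constructions; no facts.

## References

* A. Cannas da Silva, V. Guillemin, A. R. Pires, *Symplectic Origami*, IMRN 2011 =
  arXiv:0909.4065, §2.3, proof of Prop. 2.8. [CannasdasilvaGuilleminPires2010]
* E. Lerman, *Symplectic cuts*, Math. Res. Lett. 2 (1995) 247–258 (the cut as a reduction of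
  `M × ℂ`).
-/

noncomputable section

open scoped Manifold ContDiff Topology RealInnerProductSpace
open Set Function Filter
open Literature.Geometry.Kaehler Literature.LinearAlgebra.Alternating

namespace Literature.Geometry.Symplectic

/-! ### The area form of `ℂ` -/

/-- The area pairing `(σ, τ) ↦ σ₁τ₂ - σ₂τ₁` on `ℂ = ℝ²` as a continuous bilinear map. [folklore] -/
def areaBilinC : ℂ →L[ℝ] ℂ →L[ℝ] ℝ :=
  (Complex.reCLM).smulRight (Complex.imCLM : ℂ →L[ℝ] ℝ) -
    (Complex.imCLM).smulRight (Complex.reCLM : ℂ →L[ℝ] ℝ)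

/-- `areaBilinC σ τ = σ₁τ₂ - σ₂τ₁`. [folklore] -/
@[simp] theorem areaBilinC_apply (σ τ : ℂ) : areaBilinC σ τ = σ.re * τ.im - σ.im * τ.re := by
  simp [areaBilinC]

/-- **The area form `dx ∧ dy` of `ℂ`** as a continuous alternating `2`-form (the
antisymmetrisation of `areaBilinC`, built as the tree's `presymplecticAltFive`). [folklore] -/
def areaAltC : ℂ [⋀^Fin 2]→L[ℝ] ℝ :=
  (2⁻¹ : ℝ) • ContinuousMultilinearMap.alternatization
    (ContinuousLinearMap.uncurryLeft
      (((continuousMultilinearCurryFin1 ℝ ℂ ℝ).symm : (ℂ →L[ℝ] ℝ) →L[ℝ] _).comp areaBilinC))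

/-- `areaAltC ![σ, τ] = σ₁τ₂ - σ₂τ₁`. [folklore] -/
@[simp] theorem areaAltC_apply (σ τ : ℂ) : areaAltC ![σ, τ] = σ.re * τ.im - σ.im * τ.re := by
  change (((2⁻¹ : ℝ) • ContinuousMultilinearMap.alternatization _ : ℂ [⋀^Fin 2]→L[ℝ] ℝ))
    (show Fin 2 → ℂ from ![σ, τ]) = _
  rw [ContinuousAlternatingMap.smul_apply, ContinuousMultilinearMap.alternatization_apply_apply]
  have huniv : (Finset.univ : Finset (Equiv.Perm (Fin 2))) = {1, Equiv.swap 0 1} := by decide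
  rw [huniv, Finset.sum_pair (by decide)]
  simp [Equiv.Perm.sign_swap', Units.smul_def]
  ring

/-- **The area form of `ℂ` as a (constant) `2`-form on the manifold `ℂ`.** [folklore] -/
def areaFormC : MForm 𝓘(ℝ, ℂ) ℂ ℝ 2 := fun _ => areaAltC

/-- Values of the area form. [folklore] -/
@[simp] theorem areaFormC_apply (w σ τ : ℂ) : areaFormC w ![σ, τ] = σ.re * τ.im - σ.im * τ.re :=
  areaAltC_apply σ τ

/-- The chart representative of a form on the model vector space is the form itself. [folklore] -/
theorem inChart_eq_self_model {V : Type*} [NormedAddCommGroup V] [NormedSpace ℝ V] {k : ℕ}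
    (β : MForm 𝓘(ℝ, V) V ℝ k) (x : V) : β.inChart x = β := by
  funext y
  ext v
  simp [MForm.inChart_apply]
  rfl

/-- The area form is smooth (it is constant). [folklore] -/
theorem isSmoothForm_areaFormC : IsSmoothForm areaFormC := by
  intro x
  rw [inChart_eq_self_model]
  exact contDiffWithinAt_const

/-- The area form is closed (it is constant). [folklore] -/
theorem isClosedForm_areaFormC : IsClosedForm areaFormC := by
  show mextDeriv areaFormC = 0
  funext x
  rw [mextDeriv_eq_extDeriv]
  show extDeriv (fun _ : ℂ => areaAltC) x = 0
  rw [extDeriv, fderiv_fun_const, Pi.zero_apply,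
    ← ContinuousAlternatingMap.alternatizeUncurryFinCLM_apply, map_zero]

/-! ### Pull-backs along the projections of `N × ℂ` -/

variable {m : ℕ} {N : Type*} [TopologicalSpace N] [ChartedSpace (EuclideanSpace ℝ (Fin m)) N]
  [IsManifold (𝓡 m) ∞ N]

omit [IsManifold (𝓡 m) ∞ N] in
/-- `d(pr₁)(a, σ) = a` on `N × ℂ`. [folklore] -/
theorem mfderiv_fst_prod_complex (x : N × ℂ) (a : EuclideanSpace ℝ (Fin m)) (σ : ℂ) :
    mfderiv ((𝓡 m).prod 𝓘(ℝ, ℂ)) (𝓡 m) (Prod.fst : N × ℂ → N) x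
      (((a, σ) : EuclideanSpace ℝ (Fin m) × ℂ)) = a := by
  rw [mfderiv_fst]
  rfl

omit [IsManifold (𝓡 m) ∞ N] in
/-- `d(pr₂)(a, σ) = σ` on `N × ℂ`. [folklore] -/
theorem mfderiv_snd_prod_complex (x : N × ℂ) (a : EuclideanSpace ℝ (Fin m)) (σ : ℂ) :
    mfderiv ((𝓡 m).prod 𝓘(ℝ, ℂ)) 𝓘(ℝ, ℂ) (Prod.snd : N × ℂ → ℂ) x
      (((a, σ) : EuclideanSpace ℝ (Fin m) × ℂ)) = σ := by
  rw [mfderiv_snd]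
  rfl

omit [IsManifold (𝓡 m) ∞ N] in
/-- Values of a pulled-back `2`-form along `pr₁ : N × ℂ → N`. [folklore] -/
theorem pullback_fst_prod_complex_apply_two (β : MForm (𝓡 m) N ℝ 2) (n : N) (w : ℂ)
    (a b : EuclideanSpace ℝ (Fin m)) (σ τ : ℂ) :
    (β.pullback ((𝓡 m).prod 𝓘(ℝ, ℂ)) (Prod.fst : N × ℂ → N)) (n, w)
      ![((a, σ) : EuclideanSpace ℝ (Fin m) × ℂ), ((b, τ) : EuclideanSpace ℝ (Fin m) × ℂ)] =
      β n ![a, b] := by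
  rw [MForm.pullback_apply]
  have hvec : (fun i : Fin 2 => mfderiv ((𝓡 m).prod 𝓘(ℝ, ℂ)) (𝓡 m) (Prod.fst : N × ℂ → N) (n, w)
      (![((a, σ) : EuclideanSpace ℝ (Fin m) × ℂ), ((b, τ) : EuclideanSpace ℝ (Fin m) × ℂ)] i)) =
      ![a, b] := by
    funext i
    fin_cases i
    · exact mfderiv_fst_prod_complex (n, w) a σ
    · exact mfderiv_fst_prod_complex (n, w) b τ
  exact congrArg (β n) hvec

omit [IsManifold (𝓡 m) ∞ N] in
/-- Values of a pulled-back `1`-form along `pr₁ : N × ℂ → N`. [folklore] -/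
theorem pullback_fst_prod_complex_apply_one (β : MForm (𝓡 m) N ℝ 1) (n : N) (w : ℂ)
    (a : EuclideanSpace ℝ (Fin m)) (σ : ℂ) :
    (β.pullback ((𝓡 m).prod 𝓘(ℝ, ℂ)) (Prod.fst : N × ℂ → N)) (n, w)
      ![((a, σ) : EuclideanSpace ℝ (Fin m) × ℂ)] = β n ![a] := by
  rw [MForm.pullback_apply]
  have hvec : (fun i : Fin 1 => mfderiv ((𝓡 m).prod 𝓘(ℝ, ℂ)) (𝓡 m) (Prod.fst : N × ℂ → N) (n, w)
      (![((a, σ) : EuclideanSpace ℝ (Fin m) × ℂ)] i)) = ![a] := by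
    funext i
    fin_cases i
    exact mfderiv_fst_prod_complex (n, w) a σ
  exact congrArg (β n) hvec

omit [IsManifold (𝓡 m) ∞ N] in
/-- Values of the pulled-back area form along `pr₂ : N × ℂ → ℂ`. [folklore] -/
theorem pullback_snd_areaFormC_apply (n : N) (w : ℂ) (a b : EuclideanSpace ℝ (Fin m)) (σ τ : ℂ) :
    (areaFormC.pullback ((𝓡 m).prod 𝓘(ℝ, ℂ)) (Prod.snd : N × ℂ → ℂ)) (n, w)
      ![((a, σ) : EuclideanSpace ℝ (Fin m) × ℂ), ((b, τ) : EuclideanSpace ℝ (Fin m) × ℂ)] =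
      σ.re * τ.im - σ.im * τ.re := by
  rw [MForm.pullback_apply]
  have hvec : (fun i : Fin 2 => mfderiv ((𝓡 m).prod 𝓘(ℝ, ℂ)) 𝓘(ℝ, ℂ) (Prod.snd : N × ℂ → ℂ) (n, w)
      (![((a, σ) : EuclideanSpace ℝ (Fin m) × ℂ), ((b, τ) : EuclideanSpace ℝ (Fin m) × ℂ)] i)) =
      ![σ, τ] := by
    funext i
    fin_cases i
    · exact mfderiv_snd_prod_complex (n, w) a σ
    · exact mfderiv_snd_prod_complex (n, w) b τ
  exact (congrArg (areaFormC ((n, w) : N × ℂ).2) hvec).trans (areaFormC_apply w σ τ)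

/-- The pull-back of a smooth form along `pr₁ : N × ℂ → N` is smooth. [folklore] -/
theorem isSmoothForm_pullback_fst_prod_complex {k : ℕ} {β : MForm (𝓡 m) N ℝ k}
    (hβ : IsSmoothForm β) :
    IsSmoothForm (β.pullback ((𝓡 m).prod 𝓘(ℝ, ℂ)) (Prod.fst : N × ℂ → N)) :=
  (isSmoothForm_iff_smoothAt _).2 fun _ =>
    MForm.SmoothAt.pullback (Eventually.of_forall fun _ => contMDiffAt_fst)
      ((isSmoothForm_iff_smoothAt β).1 hβ _)

/-- The pull-back of the area form along `pr₂ : N × ℂ → ℂ` is smooth. [folklore] -/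
theorem isSmoothForm_pullback_snd_areaFormC :
    IsSmoothForm (areaFormC.pullback ((𝓡 m).prod 𝓘(ℝ, ℂ)) (Prod.snd : N × ℂ → ℂ)) :=
  (isSmoothForm_iff_smoothAt _).2 fun _ =>
    MForm.SmoothAt.pullback (Eventually.of_forall fun _ => contMDiffAt_snd)
      ((isSmoothForm_iff_smoothAt areaFormC).1 isSmoothForm_areaFormC _)

/-- `d` commutes with the pull-back along `pr₁ : N × ℂ → N`. [folklore] -/
theorem mextDeriv_pullback_fst_prod_complex {k : ℕ} {β : MForm (𝓡 m) N ℝ k}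
    (hβ : IsSmoothForm β) :
    mextDeriv (β.pullback ((𝓡 m).prod 𝓘(ℝ, ℂ)) (Prod.fst : N × ℂ → N)) =
      (mextDeriv β).pullback ((𝓡 m).prod 𝓘(ℝ, ℂ)) (Prod.fst : N × ℂ → N) :=
  funext fun _ => mextDeriv_pullback_apply (Eventually.of_forall fun _ => contMDiffAt_fst)
    ((isSmoothForm_iff_smoothAt β).1 hβ _)

/-- The pull-back of the area form along `pr₂` is closed. [folklore] -/
theorem isClosedForm_pullback_snd_areaFormC :
    IsClosedForm (areaFormC.pullback ((𝓡 m).prod 𝓘(ℝ, ℂ)) (Prod.snd : N × ℂ → ℂ)) := by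
  show mextDeriv _ = 0
  funext x
  rw [mextDeriv_pullback_apply (Eventually.of_forall fun _ => contMDiffAt_snd)
    ((isSmoothForm_iff_smoothAt areaFormC).1 isSmoothForm_areaFormC _)]
  have h0 : mextDeriv areaFormC = 0 := isClosedForm_areaFormC
  rw [h0, MForm.pullback_zero]

/-! ### The function `|w|²` on `N × ℂ` and its differential in the product chart -/

omit [IsManifold (𝓡 m) ∞ N] in
/-- `(n, w) ↦ |w|²` is `C^∞` on `N × ℂ`. [folklore] -/
theorem contMDiff_normSq_snd :
    ContMDiff ((𝓡 m).prod 𝓘(ℝ, ℂ)) 𝓘(ℝ, ℝ) ∞ (fun q : N × ℂ => ‖q.2‖ ^ 2) :=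
  ((contDiff_norm_sq ℝ (n := ∞)).comp_contMDiff contMDiff_snd)

omit [IsManifold (𝓡 m) ∞ N] in
/-- In the product chart at `x`, the inverse chart acts as the identity on the `ℂ`-factor.
[folklore] -/
theorem extChartAt_prod_complex_symm_snd (x : N × ℂ) (p : EuclideanSpace ℝ (Fin m) × ℂ) :
    ((extChartAt ((𝓡 m).prod 𝓘(ℝ, ℂ)) x).symm p).2 = p.2 := by
  rw [extChartAt_prod]
  rfl

omit [IsManifold (𝓡 m) ∞ N] in
/-- **The differential of `|w|²` read in the product chart is `2⟪w, ·⟫`**: its value on `(a, σ)`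
at the point `(n, w)` is `2⟪w, σ⟫`. [folklore] -/
theorem fderivWithin_normSq_snd_chart (n : N) (w : ℂ) (a : EuclideanSpace ℝ (Fin m)) (σ : ℂ) :
    fderivWithin ℝ ((fun q : N × ℂ => ‖q.2‖ ^ 2) ∘ (extChartAt ((𝓡 m).prod 𝓘(ℝ, ℂ)) (n, w)).symm)
      (range ((𝓡 m).prod 𝓘(ℝ, ℂ))) (extChartAt ((𝓡 m).prod 𝓘(ℝ, ℂ)) (n, w) (n, w))
      (((a, σ) : EuclideanSpace ℝ (Fin m) × ℂ)) = 2 * ⟪w, σ⟫ := by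
  have hfun : ((fun q : N × ℂ => ‖q.2‖ ^ 2) ∘ (extChartAt ((𝓡 m).prod 𝓘(ℝ, ℂ)) (n, w)).symm) =
      fun p : EuclideanSpace ℝ (Fin m) × ℂ => ‖p.2‖ ^ 2 := by
    funext p
    simp only [Function.comp_apply, extChartAt_prod_complex_symm_snd]
  have hpt : extChartAt ((𝓡 m).prod 𝓘(ℝ, ℂ)) (n, w) (n, w) = (extChartAt (𝓡 m) n n, w) := by
    rw [extChartAt_prod]
    rfl
  rw [hfun, ModelWithCorners.Boundaryless.range_eq_univ, fderivWithin_univ, hpt]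
  have hd : HasFDerivAt (fun p : EuclideanSpace ℝ (Fin m) × ℂ => ‖p.2‖ ^ 2)
      ((2 : ℕ) • (innerSL ℝ ((extChartAt (𝓡 m) n n, w) : EuclideanSpace ℝ (Fin m) × ℂ).2).comp
        (ContinuousLinearMap.snd ℝ (EuclideanSpace ℝ (Fin m)) ℂ))
      ((extChartAt (𝓡 m) n n, w) : EuclideanSpace ℝ (Fin m) × ℂ) :=
    HasFDerivAt.norm_sq hasFDerivAt_snd
  rw [hd.fderiv]
  simp [two_smul, two_mul]

/-! ### The form `prodCutForm` and its values -/

/-- **The pull-back to `N × ℂ` of the reduced form of the symplectic cut**: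
`p^*ωZ + d(|w|² p^*α) - 2 dx∧dy` (Cannas da Silva–Guillemin–Pires, proof of Prop. 2.8: the
reduced space of `Z × (-ε,ε) × ℂ`, whose reduced form pulls back to this one along
`(x, w) ↦ (x, |w|², w)`-type identifications; written out directly).
[cite: CannasdasilvaGuilleminPires2010, Prop. 2.8] -/
def prodCutForm (ωZ : MForm (𝓡 m) N ℝ 2) (α : MForm (𝓡 m) N ℝ 1) :
    MForm ((𝓡 m).prod 𝓘(ℝ, ℂ)) (N × ℂ) ℝ 2 :=
  ωZ.pullback ((𝓡 m).prod 𝓘(ℝ, ℂ)) (Prod.fst : N × ℂ → N) +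
    mextDeriv ((fun q : N × ℂ => ‖q.2‖ ^ 2) • α.pullback ((𝓡 m).prod 𝓘(ℝ, ℂ)) (Prod.fst : N × ℂ → N)) +
    (-2 : ℝ) • areaFormC.pullback ((𝓡 m).prod 𝓘(ℝ, ℂ)) (Prod.snd : N × ℂ → ℂ)

omit [IsManifold (𝓡 m) ∞ N] in
/-- `removeNth` on pairs. [folklore] -/
private theorem removeNth_zero_two' {X : Type*} (u w : X) :
    (0 : Fin 2).removeNth ![u, w] = ![w] := by
  funext i; fin_cases i; rfl

omit [IsManifold (𝓡 m) ∞ N] in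
/-- `removeNth` on pairs. [folklore] -/
private theorem removeNth_one_two' {X : Type*} (u w : X) :
    (1 : Fin 2).removeNth ![u, w] = ![u] := by
  funext i; fin_cases i; rfl

/-- `wedgeOne θ η` on a pair, for a `1`-form `η`: `θ(u) η(w) - θ(w) η(u)`. [folklore] -/
private theorem wedgeOne_apply_pair_real' {V : Type*} [NormedAddCommGroup V] [NormedSpace ℝ V]
    (θ : V →L[ℝ] ℝ) (η : V [⋀^Fin 1]→L[ℝ] ℝ) (u w : V) :
    wedgeOne θ η ![u, w] = θ u * η ![w] - θ w * η ![u] := by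
  rw [wedgeOne_apply, Fin.sum_univ_two]
  simp only [Fin.val_zero, pow_zero, one_smul, Fin.val_one, pow_one, neg_smul, smul_eq_mul,
    Matrix.cons_val_zero, Matrix.cons_val_one]
  rw [show (0 : Fin 2).removeNth ![u, w] = ![w] from removeNth_zero_two' u w,
    show (1 : Fin 2).removeNth ![u, w] = ![u] from removeNth_one_two' u w]
  ring

/-- **The values of `prodCutForm`**:
`Ω_{(n,w)}((a,σ),(b,τ)) = ωZ_n(a,b) + |w|² dα_n(a,b) + 2⟪w,σ⟫ α_n(b) - 2⟪w,τ⟫ α_n(a)`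
`- 2(σ₁τ₂ - σ₂τ₁)`. [cite: CannasdasilvaGuilleminPires2010, Prop. 2.8] -/
theorem prodCutForm_apply (ωZ : MForm (𝓡 m) N ℝ 2) {α : MForm (𝓡 m) N ℝ 1} (hα : IsSmoothForm α)
    (n : N) (w : ℂ) (a b : EuclideanSpace ℝ (Fin m)) (σ τ : ℂ) :
    prodCutForm ωZ α (n, w)
      ![((a, σ) : EuclideanSpace ℝ (Fin m) × ℂ), ((b, τ) : EuclideanSpace ℝ (Fin m) × ℂ)] =
      ωZ n ![a, b] + ‖w‖ ^ 2 * mextDeriv α n ![a, b] +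
        (2 * ⟪w, σ⟫ * α n ![b] - 2 * ⟪w, τ⟫ * α n ![a]) -
        2 * (σ.re * τ.im - σ.im * τ.re) := by
  have hP1s : IsSmoothForm (α.pullback ((𝓡 m).prod 𝓘(ℝ, ℂ)) (Prod.fst : N × ℂ → N)) :=
    isSmoothForm_pullback_fst_prod_complex hα
  have hρ : MDifferentiableAt ((𝓡 m).prod 𝓘(ℝ, ℂ)) 𝓘(ℝ, ℝ) (fun q : N × ℂ => ‖q.2‖ ^ 2) (n, w) :=
    (contMDiff_normSq_snd (m := m) (N := N)).mdifferentiableAt (by norm_num)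
  show (ωZ.pullback ((𝓡 m).prod 𝓘(ℝ, ℂ)) (Prod.fst : N × ℂ → N)) (n, w)
      ![((a, σ) : EuclideanSpace ℝ (Fin m) × ℂ), ((b, τ) : EuclideanSpace ℝ (Fin m) × ℂ)] +
    mextDeriv ((fun q : N × ℂ => ‖q.2‖ ^ 2) •
        α.pullback ((𝓡 m).prod 𝓘(ℝ, ℂ)) (Prod.fst : N × ℂ → N)) (n, w)
      ![((a, σ) : EuclideanSpace ℝ (Fin m) × ℂ), ((b, τ) : EuclideanSpace ℝ (Fin m) × ℂ)] +
    (-2 : ℝ) * (areaFormC.pullback ((𝓡 m).prod 𝓘(ℝ, ℂ)) (Prod.snd : N × ℂ → ℂ)) (n, w)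
      ![((a, σ) : EuclideanSpace ℝ (Fin m) × ℂ), ((b, τ) : EuclideanSpace ℝ (Fin m) × ℂ)] = _
  rw [pullback_fst_prod_complex_apply_two,
    mextDeriv_fun_smul_apply hρ ((isSmoothForm_iff_smoothAt _).1 hP1s _),
    mextDeriv_pullback_fst_prod_complex hα, pullback_fst_prod_complex_apply_two,
    pullback_snd_areaFormC_apply]
  have hw := wedgeOne_apply_pair_real'
    (fderivWithin ℝ ((fun q : N × ℂ => ‖q.2‖ ^ 2) ∘ (extChartAt ((𝓡 m).prod 𝓘(ℝ, ℂ)) (n, w)).symm)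
      (range ((𝓡 m).prod 𝓘(ℝ, ℂ))) (extChartAt ((𝓡 m).prod 𝓘(ℝ, ℂ)) (n, w) (n, w)))
    ((α.pullback ((𝓡 m).prod 𝓘(ℝ, ℂ)) (Prod.fst : N × ℂ → N)) (n, w))
    ((a, σ) : EuclideanSpace ℝ (Fin m) × ℂ) ((b, τ) : EuclideanSpace ℝ (Fin m) × ℂ)
  rw [fderivWithin_normSq_snd_chart, fderivWithin_normSq_snd_chart] at hw
  have hw' := hw.trans (congrArg₂ (fun x y : ℝ => 2 * ⟪w, σ⟫ * x - 2 * ⟪w, τ⟫ * y)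
    (pullback_fst_prod_complex_apply_one α n w b τ) (pullback_fst_prod_complex_apply_one α n w a σ))
  have hs : ‖((n, w) : N × ℂ).2‖ ^ 2 • mextDeriv α n ![a, b] = ‖w‖ ^ 2 * mextDeriv α n ![a, b] := rfl
  exact (congrArg₂ (fun x y : ℝ => ωZ n ![a, b] + (x + y) + (-2 : ℝ) * (σ.re * τ.im - σ.im * τ.re))
    hs hw').trans (by ring)

/-- **`prodCutForm` is smooth** (for smooth `ωZ`, `α`). [folklore] -/
theorem isSmoothForm_prodCutForm {ωZ : MForm (𝓡 m) N ℝ 2} (hωZ : IsSmoothForm ωZ)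
    {α : MForm (𝓡 m) N ℝ 1} (hα : IsSmoothForm α) : IsSmoothForm (prodCutForm ωZ α) :=
  ((isSmoothForm_pullback_fst_prod_complex hωZ).add
    (isSmoothForm_mextDeriv (inChart_mextDeriv_holds _ _ _)
      (IsSmoothForm.fun_smul' (contMDiff_normSq_snd (m := m) (N := N))
        (isSmoothForm_pullback_fst_prod_complex hα)))).add
    ((isSmoothForm_pullback_snd_areaFormC (m := m) (N := N)).smul (-2 : ℝ))

/-- **`prodCutForm` is closed** when `ωZ` is closed (`d p^* = p^* d`, `dd = 0`, `dx∧dy` is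
constant). [cite: CannasdasilvaGuilleminPires2010, Prop. 2.8] -/
theorem isClosedForm_prodCutForm {ωZ : MForm (𝓡 m) N ℝ 2} (hωZ : IsSmoothForm ωZ)
    (hωZc : IsClosedForm ωZ) {α : MForm (𝓡 m) N ℝ 1} (hα : IsSmoothForm α) :
    IsClosedForm (prodCutForm ωZ α) := by
  have hsm : IsSmoothForm ((fun q : N × ℂ => ‖q.2‖ ^ 2) •
      α.pullback ((𝓡 m).prod 𝓘(ℝ, ℂ)) (Prod.fst : N × ℂ → N)) :=
    IsSmoothForm.fun_smul' (contMDiff_normSq_snd (m := m) (N := N))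
      (isSmoothForm_pullback_fst_prod_complex hα)
  have h1 : IsSmoothForm (ωZ.pullback ((𝓡 m).prod 𝓘(ℝ, ℂ)) (Prod.fst : N × ℂ → N)) :=
    isSmoothForm_pullback_fst_prod_complex hωZ
  have h2 : IsSmoothForm (mextDeriv ((fun q : N × ℂ => ‖q.2‖ ^ 2) •
      α.pullback ((𝓡 m).prod 𝓘(ℝ, ℂ)) (Prod.fst : N × ℂ → N))) :=
    isSmoothForm_mextDeriv (inChart_mextDeriv_holds _ _ _) hsm
  have h3 : IsSmoothForm ((-2 : ℝ) • areaFormC.pullback ((𝓡 m).prod 𝓘(ℝ, ℂ))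
      (Prod.snd : N × ℂ → ℂ)) :=
    (isSmoothForm_pullback_snd_areaFormC (m := m) (N := N)).smul (-2 : ℝ)
  unfold IsClosedForm prodCutForm
  rw [mextDeriv_add (h1.add h2) h3, mextDeriv_add h1 h2,
    mextDeriv_pullback_fst_prod_complex hωZ,
    mextDeriv_mextDeriv (inChart_mextDeriv_holds _ _ _) hsm, add_zero, mextDeriv_smul]
  have h0 : mextDeriv ωZ = 0 := hωZc
  have ha : mextDeriv (areaFormC.pullback ((𝓡 m).prod 𝓘(ℝ, ℂ)) (Prod.snd : N × ℂ → ℂ)) = 0 :=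
    isClosedForm_pullback_snd_areaFormC
  rw [h0, MForm.pullback_zero, zero_add, ha, smul_zero]

/-! ### The real slice: `prodCutForm` restricts to the model form -/

/-- **Along the real slice `w = t ∈ ℝ`, on real tangent vectors, `prodCutForm` is the model form
`p^*ωZ + d(t² p^*α)` of `OrigamiModelForm.lean`**:
`Ω_{(n,t)}((a,σ),(b,τ)) = ωZ_n(a,b) + t² dα_n(a,b) + 2t(σ α_n(b) - τ α_n(a))` for real `σ, τ`
(`⟪t, σ⟫ = tσ`, and the area of two real vectors vanishes).
[cite: CannasdasilvaGuilleminPires2010, Prop. 2.8] -/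
theorem prodCutForm_apply_ofReal (ωZ : MForm (𝓡 m) N ℝ 2) {α : MForm (𝓡 m) N ℝ 1}
    (hα : IsSmoothForm α) (n : N) (t : ℝ) (a b : EuclideanSpace ℝ (Fin m)) (σ τ : ℝ) :
    prodCutForm ωZ α (n, (t : ℂ))
      ![((a, (σ : ℂ)) : EuclideanSpace ℝ (Fin m) × ℂ), ((b, (τ : ℂ)) : EuclideanSpace ℝ (Fin m) × ℂ)] =
      ωZ n ![a, b] + (t ^ 2 * mextDeriv α n ![a, b] + 2 * t * (σ * α n ![b] - τ * α n ![a])) := by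
  rw [prodCutForm_apply ωZ hα]
  have h1 : ⟪(t : ℂ), (σ : ℂ)⟫ = t * σ := by
    rw [Complex.inner, Complex.conj_ofReal, ← Complex.ofReal_mul, Complex.ofReal_re, mul_comm]
  have h2 : ⟪(t : ℂ), (τ : ℂ)⟫ = t * τ := by
    rw [Complex.inner, Complex.conj_ofReal, ← Complex.ofReal_mul, Complex.ofReal_re, mul_comm]
  rw [h1, h2, Complex.norm_real, Real.norm_eq_abs, sq_abs]
  simp only [Complex.ofReal_re, Complex.ofReal_im, mul_zero, zero_mul, sub_zero]
  ring

/-- The model-form comparison in the packaged form of `OrigamiModelForm.modelForm_apply`: the two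
value formulas agree. [cite: CannasGuilleminWoodward2000, Thm. 1] -/
theorem prodCutForm_apply_ofReal_eq_modelForm (ωZ : MForm (𝓡 m) N ℝ 2) {α : MForm (𝓡 m) N ℝ 1}
    (hα : IsSmoothForm α) (n : N) (t : ℝ) (a b : EuclideanSpace ℝ (Fin m)) (σ τ : ℝ) :
    prodCutForm ωZ α (n, (t : ℂ))
      ![((a, (σ : ℂ)) : EuclideanSpace ℝ (Fin m) × ℂ), ((b, (τ : ℂ)) : EuclideanSpace ℝ (Fin m) × ℂ)] =
      (ωZ.pullback ((𝓡 m).prod 𝓘(ℝ, ℝ)) (Prod.fst : N × ℝ → N) +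
        mextDeriv ((fun q : N × ℝ => q.2 ^ 2) •
          α.pullback ((𝓡 m).prod 𝓘(ℝ, ℝ)) (Prod.fst : N × ℝ → N))) (n, t)
        ![((a, σ) : EuclideanSpace ℝ (Fin m) × ℝ), ((b, τ) : EuclideanSpace ℝ (Fin m) × ℝ)] := by
  rw [prodCutForm_apply_ofReal ωZ hα, modelForm_apply ωZ hα]

end Literature.Geometry.Symplectic

end
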